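import Literature.NumberTheory.Irrationality.Zudilin2014.SecondTalePolar
import Summits.KontsevichZagierPeriods.Zeta5Search.TwoTaleP15SliceLemmas

/-!
# The two-tale point P15: the SLICE LEMMA — `p̂_n ∈ ℤ_p` for every prime `p > 17n`

HONEST FRAMING: systematic search; no irrationality claim unless certified.

Cell pub-zeta5, T3 service (denominator side only; nothing about irrationality).  This discharges the window
`(17n, 26n+1]` of fam-denom's open input `TopWindowT` for the (bmiss)-free closing of the P15 chain
(`families/denom/P15KERNEL.md` §10.7 "slice law", §10.8; P1 `pub-zeta5-p1/TWODECAY-ROUTE-g10.md`):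

* **`padicNorm_formPT_le_one_of_gt : 1 ≤ n → 17n < p → ‖formPT (aT n) (bT n)‖_p ≤ 1`.**

Proof (fam-denom g7's slice law, made termwise).  Write `p̂_n = ± Σ_k (2A_k S₂(m_k) + B_k S₁(m_k))`,
`m_k = 2k − 26n − 2`, `S_s(m) = Σ_{ℓ≤m} (−1)^{ℓ−1}/ℓ^s`.  For `p > 17n`: `A_k, B_k ∈ ℤ_p` (`TwoTaleP15SliceLemmas`),
`m_k ≤ 26n < 2p`, so `S_s(m_k) ≡ [p ≤ m_k]/p^s (mod ℤ_p)` and the `k`-th term is `≡ (2A_k + pB_k)/p²`.  By the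
partial-fraction decomposition of `R̂` ([Zudilin 2014, §6], tree `RT_eq_polar`) at the half-integer point
`t_k = p/2 − k`:  `R̂(t_k) = A_k/(p/2)² + B_k/(p/2) + Σ_{j≠k} (A_j/(t_k+j)² + B_j/(t_k+j))` with `t_k + j = (p+2(j−k))/2`
a `p`-adic unit (`0 < |j−k| ≤ 13n < p`), so `(2A_k + pB_k)/p² ≡ ½R̂(t_k) (mod ℤ_p)`; and `R̂(t_k) = 0` if
`2k − p ≤ 32n+1` (a zero of the doubled numerator block), while for `2k − p ≥ 32n+2` (forcing `p ≤ 20n`, `k ≥ 24n+2`)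
the numerator factor `t_k + (k−p) = −p/2` (`6n+1 ≤ k−p ≤ 11n`) pays for the single denominator factor `t_k + k = p/2`:
`‖R̂(t_k)‖_p ≤ 1`.  Hence every term, and `p̂_n`, is `p`-integral.  (Exact cross-check `code/p1/g10/slice_check.py`:
398 slice terms, `n ≤ 6`, all primes in `(17n, 26n+2]`.)
-/

noncomputable section

namespace Summit.KontsevichZagierPeriods.Zeta5Search.TwoTaleP15

open Finset Polynomial
open Literature.NumberTheory.Irrationality.Zudilin2014

section Slice

variable {n : ℕ} {p : ℕ} [hp : Fact p.Prime]

/-! ### The half-integer point `t_k = p/2 − k` -/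

omit hp in
/-- `t_k + j = (p + 2(j−k))/2`. -/
theorem tk_add_eq (k j : ℤ) : (p : ℚ) / 2 - k + j = ((((p : ℤ) + 2 * (j - k)) : ℤ) : ℚ) / 2 := by
  push_cast; ring

/-- `t_k + j ≠ 0` (`p` odd). -/
theorem tk_add_ne_zero (h2 : p ≠ 2) (k j : ℤ) : (p : ℚ) / 2 - k + j ≠ 0 := by
  rw [tk_add_eq]
  intro h
  rcases div_eq_zero_iff.1 h with h | h
  · have h' : ((p : ℤ) + 2 * (j - k) : ℤ) = 0 := by exact_mod_cast h
    have h2z : (2 : ℤ) ∣ (p : ℤ) := ⟨k - j, by linarith⟩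
    have h2' : 2 ∣ p := Int.natCast_dvd_natCast.1 h2z
    exact h2 ((Nat.prime_dvd_prime_iff_eq Nat.prime_two hp.out).1 h2').symm
  · norm_num at h

/-- `‖t_k + j‖_p ≤ 1`. -/
theorem padicNorm_tk_add_le_one (h2 : p ≠ 2) (k j : ℤ) : padicNorm p ((p : ℚ) / 2 - k + j) ≤ 1 := by
  rw [tk_add_eq]; exact padicNorm_half_int_le_one h2 _

/-- `‖t_k + j‖_p = 1` for `j ≠ k`, `|j − k| < p`. -/
theorem padicNorm_tk_add_eq_one (h2 : p ≠ 2) {k j : ℤ} (hjk : j ≠ k) (hd : (j - k).natAbs < p) :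
    padicNorm p ((p : ℚ) / 2 - k + j) = 1 := by
  rw [tk_add_eq]; exact padicNorm_shift_half_eq_one h2 (sub_ne_zero.2 hjk) hd

/-- `‖t_k + k‖_p = p⁻¹`. -/
theorem padicNorm_tk_self (h2 : p ≠ 2) (k : ℤ) : padicNorm p ((p : ℚ) / 2 - k + k) = (p : ℚ)⁻¹ := by
  rw [sub_add_cancel]; exact padicNorm_half_p h2

/-- `‖2t_k + ℓ‖_p ≤ 1` (an integer). -/
theorem padicNorm_two_tk_add_le_one (k l : ℤ) : padicNorm p (2 * ((p : ℚ) / 2 - k) + l) ≤ 1 := by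
  have : 2 * ((p : ℚ) / 2 - k) + l = (((p : ℤ) - 2 * k + l : ℤ) : ℚ) := by push_cast; ring
  rw [this]; exact padicNorm.of_int _

/-- A block of `denT` not containing `k` is a unit at `t_k`. -/
theorem padicNorm_prod_tk_eq_one (h2 : p ≠ 2) {lo hi k : ℤ} (hk : k ∉ Ico lo hi)
    (hd : ∀ j ∈ Ico lo hi, (j - k).natAbs < p) :
    padicNorm p (∏ j ∈ Ico lo hi, ((p : ℚ) / 2 - k + j)) = 1 :=
  padicNorm_prod_eq_one fun j hj => padicNorm_tk_add_eq_one h2 (fun h => hk (h ▸ hj)) (hd j hj)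

/-- A block of `denT` containing `k` has norm `p⁻¹` at `t_k`. -/
theorem padicNorm_prod_tk_eq_inv (h2 : p ≠ 2) {lo hi k : ℤ} (hk : k ∈ Ico lo hi)
    (hd : ∀ j ∈ Ico lo hi, (j - k).natAbs < p) :
    padicNorm p (∏ j ∈ Ico lo hi, ((p : ℚ) / 2 - k + j)) = (p : ℚ)⁻¹ := by
  rw [← mul_prod_erase _ _ hk, padicNorm.mul, padicNorm_tk_self h2,
    padicNorm_prod_eq_one fun j hj =>
      padicNorm_tk_add_eq_one h2 (ne_of_mem_erase hj) (hd j (mem_of_mem_erase hj)), mul_one]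

/-! ### `R̂(t_k)` -/

/-- `denT(t_k) ≠ 0`: `t_k` is never a pole. -/
theorem eval_denT_tk_ne_zero (h2 : p ≠ 2) (k : ℤ) : (denT (aT n) (bT n)).eval ((p : ℚ) / 2 - k) ≠ 0 := by
  unfold denT
  rw [eval_mul]
  exact mul_ne_zero (eval_block_ne_zero fun i _ h => tk_add_ne_zero h2 k i (by rw [h]; ring))
    (eval_block_ne_zero fun i _ h => tk_add_ne_zero h2 k i (by rw [h]; ring))

omit hp in
/-- Case A: `15n+2 ≤ 2k − p ≤ 32n+1` ⇒ the doubled numerator block vanishes at `t_k`, `R̂(t_k) = 0`. -/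
theorem RT_tk_eq_zero {k : ℤ} (hlo : 15 * (n : ℤ) + 2 ≤ 2 * k - p) (hhi : 2 * k - p ≤ 32 * (n : ℤ) + 1) :
    RT (aT n) (bT n) ((p : ℚ) / 2 - k) = 0 := by
  unfold RT numT
  rw [eval_mul, eval_C, eval_mul, eval_block2]
  have hmem : 2 * k - p ∈ Ico (bT n 0) (aT n 0) := by simp [mem_Ico]; omega
  rw [prod_eq_zero hmem (by push_cast; ring), zero_mul, mul_zero, zero_div]

/-- Case B: `2k − p ≥ 32n+2`, `k ≤ 26n+1`, `p > 17n` ⇒ `‖numT(t_k)‖_p ≤ p⁻¹` (the factor `t_k + (k−p) = −p/2`). -/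
theorem padicNorm_eval_numT_tk_le (hn : 1 ≤ n) (hp17 : 17 * n < p) {k : ℤ}
    (hB : 32 * (n : ℤ) + 2 ≤ 2 * k - p) (hk : k ≤ 26 * (n : ℤ) + 1) :
    padicNorm p ((numT (aT n) (bT n)).eval ((p : ℚ) / 2 - k)) ≤ (p : ℚ)⁻¹ := by
  have h2 : p ≠ 2 := by omega
  have hp17' : 17 * (n : ℤ) < p := by exact_mod_cast hp17
  have hN : padicNorm p (normT (aT n) (bT n)) = 1 := by
    rw [padicNorm_normT_partner (sq_bound_of_gt hn hp17), Nat.div_eq_of_lt (by omega : 11 * n < p),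
      Nat.div_eq_of_lt (by omega : 17 * n < p), Nat.div_eq_of_lt (by omega : 5 * n < p)]
    simp
  unfold numT
  rw [eval_mul, eval_C, eval_mul, eval_block2, eval_block, padicNorm.mul, hN, one_mul, padicNorm.mul]
  have hD : padicNorm p (∏ l ∈ Ico (bT n 0) (aT n 0), (2 * ((p : ℚ) / 2 - k) + l)) ≤ 1 :=
    padicNorm_prod_le_one fun l _ => padicNorm_two_tk_add_le_one k l
  have hmem : k - p ∈ Ico (bT n 1) (aT n 1) := by simp [mem_Ico]; omega
  have hB1 : padicNorm p (∏ j ∈ Ico (bT n 1) (aT n 1), ((p : ℚ) / 2 - k + j)) ≤ (p : ℚ)⁻¹ := by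
    rw [← mul_prod_erase _ _ hmem, padicNorm.mul]
    have e : (p : ℚ) / 2 - k + ((k - p : ℤ) : ℚ) = -((p : ℚ) / 2) := by push_cast; ring
    rw [e, padicNorm.neg, padicNorm_half_p h2]
    calc (p : ℚ)⁻¹ * padicNorm p (∏ x ∈ (Ico (bT n 1) (aT n 1)).erase (k - p), ((p : ℚ) / 2 - k + x))
        ≤ (p : ℚ)⁻¹ * 1 := mul_le_mul_of_nonneg_left
          (padicNorm_prod_le_one fun j _ => padicNorm_tk_add_le_one h2 k j) (by positivity)
      _ = (p : ℚ)⁻¹ := mul_one _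
  calc padicNorm p (∏ l ∈ Ico (bT n 0) (aT n 0), (2 * ((p : ℚ) / 2 - k) + l))
        * padicNorm p (∏ j ∈ Ico (bT n 1) (aT n 1), ((p : ℚ) / 2 - k + j))
      ≤ 1 * (p : ℚ)⁻¹ := mul_le_mul hD hB1 (padicNorm.nonneg _) zero_le_one
    _ = (p : ℚ)⁻¹ := one_mul _

/-- Case B: `‖R̂(t_k)‖_p ≤ 1` (the numerator `p` pays for the simple pole). -/
theorem padicNorm_RT_tk_le_one (hn : 1 ≤ n) (hp17 : 17 * n < p) {k : ℤ}
    (hB : 32 * (n : ℤ) + 2 ≤ 2 * k - p) (hk : k ≤ 26 * (n : ℤ) + 1) :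
    padicNorm p (RT (aT n) (bT n) ((p : ℚ) / 2 - k)) ≤ 1 := by
  have h2 : p ≠ 2 := by omega
  have hp17' : 17 * (n : ℤ) < p := by exact_mod_cast hp17
  have hp0 : (0 : ℚ) < (p : ℚ)⁻¹ := by have := hp.out.pos; positivity
  unfold RT denT
  rw [eval_mul, eval_block, eval_block, padicNorm.div, padicNorm.mul,
    padicNorm_prod_tk_eq_one h2 (k := k) (by simp [mem_Ico]; omega)
      (fun j hj => by simp only [mem_Ico, aT_two, bT_two] at hj; omega),
    padicNorm_prod_tk_eq_inv h2 (k := k) (by simp [mem_Ico]; omega)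
      (fun j hj => by simp only [mem_Ico, aT_three, bT_three] at hj; omega),
    one_mul, div_le_iff₀ hp0, one_mul]
  exact padicNorm_eval_numT_tk_le hn hp17 hB hk

/-! ### The slice identity and the slice term -/

/-- `A_k = 0` at the simple poles of the partner (`k ≤ 15n` or `k ≥ 24n+2`). -/
theorem coefAT_eq_zero_of_simple_partner {k : ℤ} (hk1 : 13 * (n : ℤ) + 1 ≤ k) (hk2 : k ≤ 26 * (n : ℤ) + 1)
    (h : k ≤ 15 * (n : ℤ) ∨ 24 * (n : ℤ) + 2 ≤ k) : coefAT (aT n) (bT n) k = 0 :=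
  h.elim (fun h => coefAT_of_simple ((multT_partner k).1 hk1 h))
    fun h => coefAT_of_simple ((multT_partner k).2.2 h hk2)

/-- **The slice identity**: the partial fractions of `R̂` at `t_k = p/2 − k` with the `k`-terms extracted,
`2(2A_k + pB_k)/p² = R̂(t_k) − Σ_{j≠k} A_j/(t_k+j)² − Σ_{j≠k} B_j/(t_k+j)`. -/
theorem slice_identity (hn : 1 ≤ n) (h2 : p ≠ 2) {k : ℤ} (hk1 : 15 * (n : ℤ) + 1 ≤ k)
    (hk2 : k ≤ 26 * (n : ℤ) + 1) :
    2 * ((2 * coefAT (aT n) (bT n) k + p * coefBT (aT n) (bT n) k) / (p : ℚ) ^ 2)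
      = RT (aT n) (bT n) ((p : ℚ) / 2 - k)
        - ∑ j ∈ (Ico (15 * (n : ℤ) + 1) (24 * (n : ℤ) + 2)).erase k,
            coefAT (aT n) (bT n) j / ((p : ℚ) / 2 - k + j) ^ 2
        - ∑ j ∈ (Ico (13 * (n : ℤ) + 1) (26 * (n : ℤ) + 2)).erase k,
            coefBT (aT n) (bT n) j / ((p : ℚ) / 2 - k + j) := by
  have hp0 : (p : ℚ) ≠ 0 := by exact_mod_cast hp.out.ne_zero
  obtain ⟨hA3, hB2⟩ := range_eq n
  obtain ⟨hMid, hMax, -⟩ := rangeB_eq n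
  have hPF := RT_eq_polar (admissibleT hn) (eval_denT_tk_ne_zero (n := n) h2 k)
  rw [hA3, hB2, hMid, hMax] at hPF
  have hkB : k ∈ Ico (13 * (n : ℤ) + 1) (26 * (n : ℤ) + 2) := by simp [mem_Ico]; omega
  have hAk : ∑ j ∈ Ico (15 * (n : ℤ) + 1) (24 * (n : ℤ) + 2), coefAT (aT n) (bT n) j / ((p : ℚ) / 2 - k + j) ^ 2
      = coefAT (aT n) (bT n) k / ((p : ℚ) / 2 - k + k) ^ 2
        + ∑ j ∈ (Ico (15 * (n : ℤ) + 1) (24 * (n : ℤ) + 2)).erase k,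
            coefAT (aT n) (bT n) j / ((p : ℚ) / 2 - k + j) ^ 2 := by
    by_cases hkA : k ∈ Ico (15 * (n : ℤ) + 1) (24 * (n : ℤ) + 2)
    · exact (add_sum_erase _ (fun j => coefAT (aT n) (bT n) j / ((p : ℚ) / 2 - k + j) ^ 2) hkA).symm
    · rw [erase_eq_of_notMem hkA]
      have hkA' : 24 * (n : ℤ) + 2 ≤ k := by simp [mem_Ico] at hkA; omega
      rw [coefAT_eq_zero_of_simple_partner (by omega) hk2 (Or.inr hkA'), zero_div, zero_add]
  rw [← add_sum_erase _ _ hkB, hAk, sub_add_cancel] at hPF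
  rw [hPF]
  field_simp
  ring

/-- **The slice term is `p`-integral**: `‖(2A_k + pB_k)/p²‖_p ≤ 1` for `p + 26n + 2 ≤ 2k ≤ 52n + 2`, `p > 17n`. -/
theorem padicNorm_sliceTerm_le_one (hn : 1 ≤ n) (hp17 : 17 * n < p) {k : ℤ}
    (hK : (p : ℤ) + 26 * n + 2 ≤ 2 * k) (hk2 : k ≤ 26 * (n : ℤ) + 1) :
    padicNorm p ((2 * coefAT (aT n) (bT n) k + p * coefBT (aT n) (bT n) k) / (p : ℚ) ^ 2) ≤ 1 := by
  have h2 : p ≠ 2 := by omega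
  have hp17' : 17 * (n : ℤ) < p := by exact_mod_cast hp17
  have h2n : padicNorm p (2 : ℚ) = 1 := by
    simpa using padicNorm.padicNorm_of_prime_of_ne (p := p) (q := 2) h2
  have key : (2 * coefAT (aT n) (bT n) k + p * coefBT (aT n) (bT n) k) / (p : ℚ) ^ 2
      = (RT (aT n) (bT n) ((p : ℚ) / 2 - k)
        - ∑ j ∈ (Ico (15 * (n : ℤ) + 1) (24 * (n : ℤ) + 2)).erase k,
            coefAT (aT n) (bT n) j / ((p : ℚ) / 2 - k + j) ^ 2
        - ∑ j ∈ (Ico (13 * (n : ℤ) + 1) (26 * (n : ℤ) + 2)).erase k,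
            coefBT (aT n) (bT n) j / ((p : ℚ) / 2 - k + j)) / 2 := by
    rw [← slice_identity hn h2 (by omega) hk2]; ring
  rw [key, padicNorm.div, h2n, div_one]
  have hRT : padicNorm p (RT (aT n) (bT n) ((p : ℚ) / 2 - k)) ≤ 1 := by
    rcases le_or_gt (2 * k - (p : ℤ)) (32 * (n : ℤ) + 1) with hA | hB
    · rw [RT_tk_eq_zero (by omega) hA, padicNorm.zero]; exact zero_le_one
    · exact padicNorm_RT_tk_le_one hn hp17 (by omega) hk2
  have hrestA : padicNorm p (∑ j ∈ (Ico (15 * (n : ℤ) + 1) (24 * (n : ℤ) + 2)).erase k,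
      coefAT (aT n) (bT n) j / ((p : ℚ) / 2 - k + j) ^ 2) ≤ 1 := by
    refine padicNorm.sum_le' (fun j hj => ?_) zero_le_one
    have hjk := ne_of_mem_erase hj
    have hj' := mem_of_mem_erase hj
    simp only [mem_Ico] at hj'
    rw [padicNorm.div, sq, padicNorm.mul, padicNorm_tk_add_eq_one h2 hjk (by omega), mul_one, div_one]
    exact padicNorm_coefAT_le_one hn hp17 hj'.1 (by omega)
  have hrestB : padicNorm p (∑ j ∈ (Ico (13 * (n : ℤ) + 1) (26 * (n : ℤ) + 2)).erase k,
      coefBT (aT n) (bT n) j / ((p : ℚ) / 2 - k + j)) ≤ 1 := by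
    refine padicNorm.sum_le' (fun j hj => ?_) zero_le_one
    have hjk := ne_of_mem_erase hj
    have hj' := mem_of_mem_erase hj
    simp only [mem_Ico] at hj'
    rw [padicNorm.div, padicNorm_tk_add_eq_one h2 hjk (by omega), div_one]
    exact padicNorm_coefBT_le_one hn hp17 hj'.1 (by omega)
  exact (padicNorm.sub).trans (max_le ((padicNorm.sub).trans (max_le hRT hrestA)) hrestB)

/-! ### Assembly -/

/-- **Each term of `p̂_n` is `p`-integral** (`p > 17n`, `13n+1 ≤ k ≤ 26n+1`):
`‖2A_k S₂(m_k) + B_k S₁(m_k)‖_p ≤ 1`, `m_k = 2k − 26n − 2`. -/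
theorem padicNorm_term_le_one (hn : 1 ≤ n) (hp17 : 17 * n < p) {k : ℤ} (hk1 : 13 * (n : ℤ) + 1 ≤ k)
    (hk2 : k ≤ 26 * (n : ℤ) + 1) :
    padicNorm p (2 * coefAT (aT n) (bT n) k * harmAlt2 (2 * k - (26 * (n : ℤ) + 2)).toNat
      + coefBT (aT n) (bT n) k * harmAlt1 (2 * k - (26 * (n : ℤ) + 2)).toNat) ≤ 1 := by
  have h2 : p ≠ 2 := by omega
  have hp17' : 17 * (n : ℤ) < p := by exact_mod_cast hp17
  have hp0 : (p : ℚ) ≠ 0 := by exact_mod_cast hp.out.ne_zero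
  have h2le : padicNorm p (2 : ℚ) ≤ 1 := by have := padicNorm.of_int (p := p) 2; simpa using this
  have hA1 : padicNorm p (coefAT (aT n) (bT n) k) ≤ 1 := by
    rcases le_or_gt k (15 * (n : ℤ)) with h | h
    · rw [coefAT_eq_zero_of_simple_partner hk1 hk2 (Or.inl h), padicNorm.zero]; exact zero_le_one
    rcases le_or_gt k (24 * (n : ℤ) + 1) with h' | h'
    · exact padicNorm_coefAT_le_one hn hp17 (by omega) h'
    · rw [coefAT_eq_zero_of_simple_partner hk1 hk2 (Or.inr (by omega)), padicNorm.zero]; exact zero_le_one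
  have hB1 := padicNorm_coefBT_le_one hn hp17 hk1 hk2
  have h2A : padicNorm p (2 * coefAT (aT n) (bT n) k) ≤ 1 := by
    rw [padicNorm.mul]; exact mul_le_one₀ h2le (padicNorm.nonneg _) hA1
  rcases lt_or_ge (2 * k - (26 * (n : ℤ) + 2)) (p : ℤ) with hlt | hge
  · -- no `ℓ = p` term
    have hm : (2 * k - (26 * (n : ℤ) + 2)).toNat < p := by omega
    refine (padicNorm.nonarchimedean).trans (max_le ?_ ?_)
    · rw [padicNorm.mul]; exact mul_le_one₀ h2A (padicNorm.nonneg _) (padicNorm_harmAlt2_le_one hm)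
    · rw [padicNorm.mul]; exact mul_le_one₀ hB1 (padicNorm.nonneg _) (padicNorm_harmAlt1_le_one hm)
  · -- the `ℓ = p` slice
    have hpm : p ≤ (2 * k - (26 * (n : ℤ) + 2)).toNat := by omega
    have hm2 : (2 * k - (26 * (n : ℤ) + 2)).toNat < 2 * p := by omega
    have hr2 := padicNorm_harmAlt2_sub_le h2 hpm hm2
    have hr1 := padicNorm_harmAlt1_sub_le h2 hpm hm2
    have hS := padicNorm_sliceTerm_le_one hn hp17 (by omega) hk2
    have e : 2 * coefAT (aT n) (bT n) k * harmAlt2 (2 * k - (26 * (n : ℤ) + 2)).toNat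
        + coefBT (aT n) (bT n) k * harmAlt1 (2 * k - (26 * (n : ℤ) + 2)).toNat
        = (2 * coefAT (aT n) (bT n) k + p * coefBT (aT n) (bT n) k) / (p : ℚ) ^ 2
          + (2 * coefAT (aT n) (bT n) k * (harmAlt2 (2 * k - (26 * (n : ℤ) + 2)).toNat - 1 / (p : ℚ) ^ 2)
            + coefBT (aT n) (bT n) k * (harmAlt1 (2 * k - (26 * (n : ℤ) + 2)).toNat - 1 / (p : ℚ))) := by
      field_simp
      ring
    rw [e]
    refine (padicNorm.nonarchimedean).trans (max_le hS ((padicNorm.nonarchimedean).trans (max_le ?_ ?_)))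
    · rw [padicNorm.mul]; exact mul_le_one₀ h2A (padicNorm.nonneg _) hr2
    · rw [padicNorm.mul]; exact mul_le_one₀ hB1 (padicNorm.nonneg _) hr1

/-- **THE SLICE LEMMA (window `p > 17n` of `TopWindowT`)**: for every `n ≥ 1` and every prime `p > 17n`,
`‖p̂_n‖_p ≤ 1`, i.e. no prime `p > 17n` divides the denominator of `formPT (aT n) (bT n)`. -/
theorem padicNorm_formPT_le_one_of_gt (hn : 1 ≤ n) (hp17 : 17 * n < p) :
    padicNorm p (formPT (aT n) (bT n)) ≤ 1 := by
  obtain ⟨hA3, hB2⟩ := range_eq n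
  obtain ⟨hMid, hMax, h0s⟩ := rangeB_eq n
  have hsign : padicNorm p (signT (bT n)) = 1 := by
    unfold signT; rcases neg_one_pow_eq_or ℚ (bT n 2 + bT n 3).natAbs with h | h <;> rw [h] <;> simp
  unfold formPT
  rw [padicNorm.mul, hsign, one_mul, hA3, hB2, hMid, hMax, h0s]
  have hsub : Ico (15 * (n : ℤ) + 1) (24 * (n : ℤ) + 2) ⊆ Ico (13 * (n : ℤ) + 1) (26 * (n : ℤ) + 2) :=
    Ico_subset_Ico (by omega) (by omega)
  have hzero : ∀ k ∈ Ico (13 * (n : ℤ) + 1) (26 * (n : ℤ) + 2), k ∉ Ico (15 * (n : ℤ) + 1) (24 * (n : ℤ) + 2) →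
      2 * coefAT (aT n) (bT n) k * harmAlt2 (2 * k - (26 * (n : ℤ) + 2)).toNat = 0 := by
    intro k hk hk'
    simp only [mem_Ico, not_and, not_lt] at hk hk'
    rw [coefAT_eq_zero_of_simple_partner hk.1 (by omega) (by omega), mul_zero, zero_mul]
  rw [sum_subset hsub hzero, ← sum_add_distrib]
  refine padicNorm.sum_le' (fun k hk => ?_) zero_le_one
  rw [mem_Ico] at hk
  exact padicNorm_term_le_one hn hp17 hk.1 (by omega)

/-- Integer form: for `p > 17n` prime and any integer multiple `z = N · p̂_n` with `N ∈ ℤ`, `‖z‖_p ≤ ‖N‖_p`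
— in particular `p ∤ den(p̂_n)`. -/
theorem padicNorm_mul_formPT_le (hn : 1 ≤ n) (hp17 : 17 * n < p) (N : ℤ) :
    padicNorm p ((N : ℚ) * formPT (aT n) (bT n)) ≤ padicNorm p (N : ℚ) := by
  rw [padicNorm.mul]
  exact mul_le_of_le_one_right (padicNorm.nonneg _) (padicNorm_formPT_le_one_of_gt hn hp17)

/-- **The free window bound** (for the remaining window `15n < p ≤ 17n` of `TopWindowT`): for every prime with
`26n < p²`, `‖p̂_n‖_p ≤ p²` — Lemma 8 for `p̂` with `e = 0` (`E(k) ≥ 0` is a sum of carries). -/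
theorem padicNorm_formPT_le_sq (hn : 1 ≤ n) (hp2 : 26 * n < p ^ 2) :
    padicNorm p (formPT (aT n) (bT n)) ≤ (p : ℚ) ^ (2 : ℤ) := by
  have h := padicNorm_formPT_le hn hp2 (e := 0) (fun k _ _ => EZ_nonneg hp.out.pos n k)
  simpa using h

end Slice

end Summit.KontsevichZagierPeriods.Zeta5Search.TwoTaleP15

end
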